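import Summits.RiemannHypothesis.RiemannHypothesis.Theses.RuelleBand
import Summits.RiemannHypothesis.RiemannHypothesis.Theorems.ExactFirstBand.Negative.Reformulations
import Summits.RiemannHypothesis.RiemannHypothesis.Theorems.RuelleBandExactFirstBandStubEvenSymTranslate
import Summits.RiemannHypothesis.RiemannHypothesis.Theorems.RuelleBandExactFirstBandStubEvenExpSum
import Summits.RiemannHypothesis.RiemannHypothesis.Theorems.RuelleBandExactFirstBandStubEvenEngine
import Summits.RiemannHypothesis.RiemannHypothesis.Theorems.RuelleBandExactFirstBandStubEvenTestExists
import Summits.RiemannHypothesis.RiemannHypothesis.Theorems.RuelleBandExactFirstBandStubEvenTransfer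
import Summits.RiemannHypothesis.RiemannHypothesis.Theorems.RuelleBandExactFirstBandStubEvenCalibration
import HarnessLib.Audit

/-!
# Line `SketchIdeator1` (even Weil sector): the even-sector Weil criterion — the bet is EXACTLY the crux

Crux `RuelleBand.ExactFirstBand` (stmt-RiemannHypothesis-2061).  Assembly of the line's landed stubs into ONE citable,
unconditional statement: Weil positivity on the functional-equation-EVEN, REAL-valued sector of test functions
(`Re W(g ⋆ g̃) ≥ 0` for every smooth compactly supported `g` with `g(-t) = g(t)` and `g` real-valued) holds
**if and only if** every zero of `ζ` in the open critical strip lies on the critical line or on the real axis (X),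
if and only if the Riemann hypothesis.  `→` is the line's closable layer (symmetric translates `stub_evenSymTranslate`,
evenness `stub_evenExpSum`, the one-sided power-sum ENGINE `stub_evenEngine` (Landau), even real bumps
`stub_evenTestExists`, bookkeeping `stub_evenTransfer`); `←` is the calibration `stub_evenCalibration`
(X ⟹ RH ⟹ `WeilPositivity.of_riemannHypothesis`).  This sharpens the tree's Weil criterion
(`weil_criterion_holds : RiemannHypothesis ↔ WeilPositivity`, Bombieri 2000 Thm 2): positivity need only be tested on
the even real sector — the X-shaped, real-zero-blind face of Weil's form (zero side `Σ_ρ m(ρ) ĝ(ρ)²`).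
So the line's single research stub `stub_evenWeilPositivity` carries exactly the content of X (= RH in tree):
no hidden strengthening, no mechanism claimed.
-/

set_option linter.dupNamespace false

noncomputable section

open Complex

namespace Summit.RiemannHypothesis.RiemannHypothesis.Theorems.RuelleBandExactFirstBand

open Summit.RiemannHypothesis.RiemannHypothesis.Theses.RuelleBand
open Literature.NumberTheory.LFunctions

/-- **The even-sector Weil criterion (bet ⟺ X).**  Weil positivity on even real-valued test functions holds iff
every zero of `ζ` with `0 < Re s < 1` has `Re s = 1/2` or `Im s = 0`.  `→`: `stub_evenTransfer` fed with the landed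
engine and bookkeeping stubs; `←`: `stub_evenCalibration`. [folklore] -/
theorem stub_evenCriterion_iff :
    (∀ g : ℝ → ℂ, IsWeilTest g → (∀ t : ℝ, g (-t) = g t) → (∀ t : ℝ, (g t).im = 0) →
      0 ≤ (weilQuadratic g).re) ↔
    (∀ s : ℂ, riemannZeta s = 0 → 0 < s.re → s.re < 1 → s.re = 1 / 2 ∨ s.im = 0) :=
  ⟨fun h => stub_evenTransfer stub_evenEngine stub_evenSymTranslate stub_evenExpSum stub_evenTestExists h,
    fun hX => stub_evenCalibration hX⟩

/-- **The even-sector Weil criterion, RH form**: the Riemann hypothesis holds iff `Re W(g ⋆ g̃) ≥ 0` for every smooth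
compactly supported `g : ℝ → ℂ` that is even and real-valued (X ⟺ RH by
`Negative.exactFirstBand_iff_riemannHypothesis`: `ζ` has no zeros on `(0,1)`). A sharpening of Weil's criterion
`weil_criterion_holds` (all test functions) to the even real sector. [folklore] -/
theorem riemannHypothesis_iff_evenWeilPositivity :
    RiemannHypothesis ↔
      ∀ g : ℝ → ℂ, IsWeilTest g → (∀ t : ℝ, g (-t) = g t) → (∀ t : ℝ, (g t).im = 0) →
        0 ≤ (weilQuadratic g).re := by
  rw [← Summit.RiemannHypothesis.Cruxes.ExactFirstBand.Negative.exactFirstBand_iff_riemannHypothesis]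
  exact stub_evenCriterion_iff.symm

end Summit.RiemannHypothesis.RiemannHypothesis.Theorems.RuelleBandExactFirstBand

end
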